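import Summits.HubbardSuperconductivity.HubbardSuperconductivity.Theses.KkFloor

/-!
# Route `KkFloor` — the two band-glue supports `KkShelfGivesBand` (stmt-HubbardSuperconductivity-10407)
# and `KkWindowGivesBand` (stmt-HubbardSuperconductivity-10408)

Both items feed the route's deciding chain `KkFloorTheorem → KkBandLift → HubbardSuperconductivity`
by producing the band hypothesis `KkBandLift` (an `L`-uniform extensive lift `ε L²` of the real part
of every sector eigenvalue of `H_L + i y L⁻² Δ_dᴴ Δ_d` on a band `y ∈ [Y₁, Y₂]`, `0 < Y₁ < Y₂`) from
one of the two cruxes: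

* `KkShelfGivesBand : KkZenoShelf → KkBandLift` — the measurement shelf gives the lift `ε L²` for
  ALL `y ≥ Y`; restrict to the band `[Y, Y + 1]` with the same `(U, δ, ε, L₀)`. Pure logic.
* `KkWindowGivesBand : KkSusceptibilityWindow → KkBandLift` — the small-`y` window gives the lift
  `κ y² L²` for `|y| ≤ y₁`; on the band `[y₁/2, y₁]` one has `|y| = y ≤ y₁` and
  `κ y² L² ≥ κ (y₁/2)² L²`, so `KkBandLift` holds with `ε := κ (y₁/2)²`, `Y₁ := y₁/2`, `Y₂ := y₁`.
  Two lines of real arithmetic.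

(Both were proved as `example`s in the planner's Sketch; this file lands them by name.) No analysis,
no new definitions. Source for the setting: T. Ransford, Potential Theory in the Complex Plane
(CUP 1995), doi:10.1017/cbo9780511623776 — only as the route's pointer; nothing from it is used here.
-/

-- the mandated namespace `Summit.<Summit>.<Problem>.Theorems` repeats `HubbardSuperconductivity`
-- (single-problem summit, D-0017), which the `dupNamespace` linter flags on every declaration
set_option linter.dupNamespace false

namespace Summit.HubbardSuperconductivity.HubbardSuperconductivity.Theorems

open Summit.HubbardSuperconductivity.HubbardSuperconductivity.Theses.KkFloor
  (KkZenoShelf KkSusceptibilityWindow KkBandLift KkShelfGivesBand KkWindowGivesBand)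

/-- **Shelf ⇒ band** (item `stmt-HubbardSuperconductivity-10407`, `KkShelfGivesBand`):
if every sector eigenvalue of `H_L + i y L⁻² Δ_dᴴ Δ_d` has real part `≥ E₀(L) + ε L²` for all
`y ≥ Y` (eventually in even `L`), then the same holds on the band `y ∈ [Y, Y + 1]` — i.e.
`KkBandLift` with `Y₁ := Y`, `Y₂ := Y + 1` and the same `(U, δ, ε, L₀)`. Pure logic. [folklore] -/
theorem kkShelfGivesBand_proof :
    Summit.HubbardSuperconductivity.HubbardSuperconductivity.Theses.KkFloor.KkShelfGivesBand := by
  unfold Summit.HubbardSuperconductivity.HubbardSuperconductivity.Theses.KkFloor.KkShelfGivesBand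
  rintro ⟨U, hU, δ, hδ, ε, hε, Y, hY, L₀, h⟩
  refine ⟨U, hU, δ, hδ, ε, hε, Y, hY, Y + 1, by linarith, L₀, ?_⟩
  intro L _ hL hEv y hy φ hφ hφ0 lam hlam
  exact h L hL hEv y hy.1 φ hφ hφ0 lam hlam

/-- **Window ⇒ band** (item `stmt-HubbardSuperconductivity-10408`, `KkWindowGivesBand`):
if every sector eigenvalue of `H_L + i y L⁻² Δ_dᴴ Δ_d` has real part `≥ E₀(L) + κ y² L²` for all
`|y| ≤ y₁` (eventually in even `L`), then on the band `y ∈ [y₁/2, y₁]` (where `|y| = y ≤ y₁` and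
`κ y² L² ≥ κ (y₁/2)² L²`) the real part is `≥ E₀(L) + κ (y₁/2)² L²` — i.e. `KkBandLift` with
`ε := κ (y₁/2)²`, `Y₁ := y₁/2`, `Y₂ := y₁`. [folklore] -/
theorem kkWindowGivesBand_proof :
    Summit.HubbardSuperconductivity.HubbardSuperconductivity.Theses.KkFloor.KkWindowGivesBand := by
  unfold Summit.HubbardSuperconductivity.HubbardSuperconductivity.Theses.KkFloor.KkWindowGivesBand
  rintro ⟨U, hU, δ, hδ, κ, hκ, y₁, hy₁, L₀, h⟩
  refine ⟨U, hU, δ, hδ, κ * (y₁ / 2) ^ 2, by positivity, y₁ / 2, by positivity, y₁, by linarith,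
    L₀, ?_⟩
  intro L _ hL hEv y hy φ hφ hφ0 lam hlam
  have hy0 : 0 ≤ y := le_trans (by positivity) hy.1
  have hyabs : |y| ≤ y₁ := by rw [abs_of_nonneg hy0]; exact hy.2
  have key := h L hL hEv y hyabs φ hφ hφ0 lam hlam
  have hsq : (y₁ / 2) ^ 2 ≤ y ^ 2 := pow_le_pow_left₀ (by positivity) hy.1 2
  have hL2 : (0 : ℝ) ≤ (L : ℝ) ^ 2 := by positivity
  have hmono : κ * (y₁ / 2) ^ 2 * (L : ℝ) ^ 2 ≤ κ * y ^ 2 * (L : ℝ) ^ 2 :=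
    mul_le_mul_of_nonneg_right (mul_le_mul_of_nonneg_left hsq hκ.le) hL2
  linarith

end Summit.HubbardSuperconductivity.HubbardSuperconductivity.Theorems
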